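import Summits.QuantumFields.BalabanUV.Beta.FP.RelInvPeriodisedChart
import Summits.QuantumFields.BalabanUV.Beta.FP.RelInvPeriodisedCoarse

/-!
# `BalabanUV.Beta.FP.RelInvPeriodisedChartCombRows` — road «FP» (binder row D1), ROUTE T row **(T-INV)**, CHART-GENERIC EDITION of
# `RelInvPeriodisedCombRows` + `RelInvPeriodisedCoarse` §3: **binder `h1` AT leaf-06's COMB ROWS AND THE (INV)-2 TRANSFER, FOR ANY PERIODISABLE
# RELATIVE-INVERSE CHART** `(A, 𝕄)` at an in-block root `toSite r` (the seven lattice letters of `RelInvPeriodisedChart` displayed as hypotheses)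

HONEST DEPENDENCY (page 1, mandatory): continuum YM on T⁴ ⇐ BetaPertH ∧ nine spine estimates (0/9 proved); BetaPertH ⇐ (D1) ∧ (D4) ∧
CAP+tail; G-an2-4 gates asym, D1 and NE2/3/4.  HONEST FRAMING (cell contract, verbatim): «discharging `BetaPertH` makes Bałaban's UV
stability UNCONDITIONAL — a real constructive-QFT result; it is NOT the continuum limit and NOT the Clay problem.»  ABSOLUTE RULE (cell
charter, verbatim): «No internally-minted statement may enter as a cited fact. Every hypothesis is either kernel-proved in this package or a
verbatim quotation of a PUBLISHED theorem with page reference. The manuscript(s) under audit are NOT citable for their own disputed steps — they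
are the thing under adjudication; programme-internal (2001/route/tribunal) claims are never citable.»

CONTENT (proofs = the rooted proofs p310903 ∕ `RelInvPeriodisedCoarse` §3 VERBATIM, the chart abstracted; comb ∕ `axEc` bookkeeping at the root BY NAME
from leaf-06's `TorusCombRows ∕ TorusCombSlots` and an2's `axEc_inl_inl ∕ axEc_inr_inr`).
* §1 **`torus_isUnit_det_kkt_combRows_of_relInv`** (fine bonds = field slots `(s, inl α)`; coarse multipliers by any injective `inr`-valued `fμ` onto the
  multiplier slots at the `Lc`-coarse sites (`hcoarse`); `τ₁ := combRowsT (toSite r) Lc M` on the field slots; `H₀ := M̂∘(fields, fields)`, `Q₁₀ := M̂∘(fμ, fields)`,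
  `M̂ := perF M 𝕄` ⇒ `IsUnit (kkt H₀ [Q₁₀; τ₁]).det`) + `_coarseSites` (coarse multipliers by the coarse-site subtype).
* §2 THE (INV)-2 TRANSFER for a chart `(A′, 𝕄′)` on the coarse box `M′` at root `toSite r′`: `coarse_det_kkt_ne_zero_fieldSlot_of_relInv`, `coarse_det_kkt_ne_zero_of_relInv`
  (any injective field presentation onto the field slots), `coarse_det_kkt_ne_zero_record_of_relInv` (index types of record) — `hId : F = c • M̂′∘(fields, fields)`,
  `c ≠ 0`, `hQ`, `hτ` displayed ⇒ `det kkt F [Q₂₀; τ₂] ≠ 0`.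
Instances: the rooted chart (`RelInvPeriodisedCombRows`, untouched) and chart (III′) (`FP/RelInvPeriodisedComb*`).  [folklore]; no `Prop`, no `def`, nothing
cited, 0 sorry; discharges NO binder of row D1; NOT (J-a), NOT (T-ID), NOT SDF, NOT D1, NOT BetaPertH, NOT continuum, NOT Clay; 0 estimates.
Unit `b2b-balaban-beta-d1-formalise-leaf-05` (gen 29), 2026-08-22; no existing file touched.
-/

noncomputable section

open scoped BigOperators Matrix

namespace Summit.QuantumFields.BalabanUV.Beta.FP.RelInvPeriodisedChartCombRows

open Matrix
open Literature.Probability.LatticeModels (Torus.proj)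
open Literature.MathematicalPhysics.QuantumFieldTheory.Balaban1983to89
open Literature.MathematicalPhysics.QuantumFieldTheory.Balaban1983to89.Beta
open Literature.MathematicalPhysics.QuantumFieldTheory.Balaban1983to89.Beta.Composition (kkt)
open B6Lemma24Torus (pbox)
open ExpKernelCalculus (MKer shiftK)
open AffineAveraging (Site box toSite)
open OneStepResolventKernel (Fib)
open Summit.QuantumFields.BalabanUV.Beta.TameKernelCalculus (Spr)
open Summit.QuantumFields.BalabanUV.Beta.ChartConjugationRelative (RelInv)
open Summit.QuantumFields.BalabanUV.Beta.AxialDressingRooted (axEc axEc_inl_inl axEc_inr_inr IsCombBondAt)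
open Summit.QuantumFields.BalabanUV.Beta.FP.KernelPeriodisationFib (Idx perF)
open Summit.QuantumFields.BalabanUV.Beta.FP.TorusCombForest (baseOf axisOf)
open Summit.QuantumFields.BalabanUV.Beta.FP.TorusCombRows (Res combBondT combRowsT combBondT_eq baseOf_mem_pbox)
open Summit.QuantumFields.BalabanUV.Beta.FP.TorusCombSlots (CombSlot combSlotOf childOf combSlotOf_childOf combSlotOf_val combBondT_injective)
open Summit.QuantumFields.BalabanUV.Beta.FP.RelInvPeriodisedChart (torus_isUnit_det_kkt_of_slots_of_relInv)
open Summit.QuantumFields.BalabanUV.Beta.FP.RelInvPeriodisedCoarse (det_kkt_smul_form_ne_zero_iff det_kkt_fromRows_submatrix_equiv exists_fieldSlot_equiv)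

variable {d : ℕ} {Lc : ℕ} [NeZero Lc]

/-! ## §1 Binder `h1` at leaf-06's comb rows, any chart -/

section CombRows

variable {r : Fin (d + 1) → ℕ} (M : Fin (d + 1) → ℕ) [∀ μ, NeZero (M μ)] {A Mh : MKer (d + 1) (Fib d)}

set_option synthInstance.maxSize 1024 in
/-- **[folklore] (T-INV) ON THE TORUS AT leaf-06's COMB ROWS, ANY CHART — binder `h1`, ANY coarse presentation** (p310903 with the chart displayed).
Fine bonds = the field slots `(s, inl α)`; coarse multipliers by any injective `fμ` onto the multiplier slots `(s, inr m)` at the coarse sites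
`Torus.proj Lc s̃ = 0` (`hcoarse`); `τ₁ := combRowsT (toSite r) Lc M` read on the field slots; `M̂ := perF M 𝕄`.  For every `d`, in-block root `r`, `Lc ≥ 1`
and every box `M` with `Lc ∣ M_i` the sliced KKT `kkt (M̂∘(fields,fields)) [M̂∘(fμ,fields); τ₁]` has a unit determinant. -/
theorem torus_isUnit_det_kkt_combRows_of_relInv (hr : r ∈ box (d + 1) Lc) (hM : ∀ i, Lc ∣ M i) (hA : Spr A) (hMh : Spr Mh)
    (hAt : ∀ t : Fin (d + 1) → ℤ, shiftK ((Lc : ℤ) • t) A = A) (hMt : ∀ t : Fin (d + 1) → ℤ, shiftK ((Lc : ℤ) • t) Mh = Mh)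
    (hrel : RelInv A Mh (axEc (toSite r) Lc))
    (hmm : ∀ (x y : Fin (d + 1) → ℤ) (κ l : Fin (d + 1)), Mh x y (Sum.inr κ) (Sum.inr l) = 0)
    (hanti : ∀ (x y : Fin (d + 1) → ℤ) (κ l : Fin (d + 1)), Mh x y (Sum.inl κ) (Sum.inr l) = -Mh y x (Sum.inr l) (Sum.inl κ))
    {μ : Type*} [Fintype μ] [DecidableEq μ] (fμ : μ → Idx M (Fib d)) (hfμ : Function.Injective fμ)
    (hμ : ∀ a : μ, ∃ m : Fin (d + 1), (fμ a).2 = Sum.inr m)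
    (hcoarse : ∀ (s : ↥(pbox M)) (m : Fin (d + 1)), ((s, Sum.inr m) : Idx M (Fib d)) ∈ Set.range fμ ↔ Torus.proj Lc (s : Site (d + 1)) = 0) :
    IsUnit (kkt
      ((perF M Mh).submatrix (fun b : ↥(pbox M) × Fin (d + 1) => ((b.1, Sum.inl b.2) : Idx M (Fib d)))
        (fun b : ↥(pbox M) × Fin (d + 1) => ((b.1, Sum.inl b.2) : Idx M (Fib d))))
      (fromRows
        ((perF M Mh).submatrix fμ (fun b : ↥(pbox M) × Fin (d + 1) => ((b.1, Sum.inl b.2) : Idx M (Fib d))))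
        ((combRowsT (toSite r) Lc M).submatrix id (fun b : ↥(pbox M) × Fin (d + 1) => ((b.1, Sum.inl b.2) : Idx M (Fib d)))))).det := by
  have hLc : 0 < Lc := Nat.pos_of_ne_zero (NeZero.ne Lc)
  have hρ : ∀ i, 0 ≤ toSite r i ∧ toSite r i < (Lc : ℤ) := fun i => by
    have h := (Fintype.mem_piFinset.mp hr) i
    rw [Finset.mem_range] at h
    exact ⟨by simp only [toSite]; positivity, by simp only [toSite]; exact_mod_cast h⟩
  set fν : ↥(pbox M) × Fin (d + 1) → Idx M (Fib d) := fun b => (b.1, Sum.inl b.2) with hfν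
  -- the comb map read in the field-slot index: `fν (cb x) = combBondT x`
  let cb : Res (toSite r) Lc M → ↥(pbox M) × Fin (d + 1) := fun x =>
    (⟨baseOf (toSite r) Lc x.site, baseOf_mem_pbox hLc hρ hM x⟩, axisOf (toSite r) Lc x.site)
  have hcbf : ∀ x, fν (cb x) = combBondT (toSite r) Lc M x := fun x => by rw [combBondT_eq hLc hρ hM x]
  have hfν_inj : Function.Injective fν := by
    rintro ⟨s, α⟩ ⟨s', α'⟩ h
    simp only [hfν, Prod.mk.injEq, Sum.inl.injEq] at h
    exact Prod.ext h.1 h.2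
  have hcb : Function.Injective cb := fun x y h =>
    combBondT_injective hLc hρ hM (by rw [← hcbf, ← hcbf, h])
  -- the comb rows read on the field slots ARE the coordinate rows of `cb`
  have hτ : (combRowsT (toSite r) Lc M).submatrix id fν = Matrix.of fun x b => if b = cb x then (1 : ℝ) else 0 := by
    ext x b
    rw [submatrix_apply, of_apply, id, combRowsT, ← hcbf]
    by_cases h : b = cb x
    · rw [if_pos (congrArg fν h), if_pos h]
    · rw [if_neg (fun e => h (hfν_inj e)), if_neg h]
  rw [hτ]
  refine torus_isUnit_det_kkt_of_slots_of_relInv M (toSite r) hM hA hMh hAt hMt hrel hmm hanti fν fμ hfν_inj hfμ (fun b => ⟨b.2, rfl⟩) hμ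
    cb hcb ?_
  -- the live reading: non-comb field slots ⊕ coarse multiplier slots
  rintro ⟨s, α | m⟩
  · rw [axEc_inl_inl]
    constructor
    · intro h
      have hnc : ¬ IsCombBondAt (toSite r) Lc α (s : Site (d + 1)) := fun hc => by
        rw [if_neg (fun h3 => h3.2.2 hc)] at h; exact zero_ne_one h
      refine Or.inl ⟨(s, α), ?_, rfl⟩
      rintro ⟨x, hx⟩
      have hslot := (combSlotOf (toSite r) Lc M hLc hρ hM x).2
      rw [combSlotOf_val, ← hcbf, hx] at hslot
      obtain ⟨m', hm', hc'⟩ := hslot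
      have e : α = m' := Sum.inl_injective hm'
      subst e
      exact hnc hc'
    · rintro (⟨b, hb, hbp⟩ | ⟨a, ha⟩)
      · have hbs : b = (s, α) := hfν_inj hbp
        subst hbs
        have hnc : ¬ IsCombBondAt (toSite r) Lc α (s : Site (d + 1)) := fun hc => by
          apply hb
          let q : CombSlot (toSite r) Lc M := ⟨(s, Sum.inl α), α, rfl, hc⟩
          refine ⟨childOf (toSite r) Lc M hLc hM q, hfν_inj ?_⟩
          rw [hcbf, ← combSlotOf_val hLc hρ hM, combSlotOf_childOf hLc hρ hM q]
        rw [if_pos ⟨rfl, rfl, hnc⟩]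
      · obtain ⟨m, hm⟩ := hμ a
        rw [ha] at hm
        exact absurd hm Sum.inl_ne_inr
  · rw [axEc_inr_inr]
    constructor
    · intro h
      have hps : Torus.proj Lc (s : Site (d + 1)) = 0 := by
        by_contra hc
        rw [if_neg (fun h3 => hc h3.2.2)] at h; exact zero_ne_one h
      exact Or.inr ((hcoarse s m).2 hps)
    · rintro (⟨b, -, hbp⟩ | ha)
      · exact absurd (congrArg Prod.snd hbp) Sum.inl_ne_inr
      · rw [if_pos ⟨rfl, rfl, (hcoarse s m).1 ha⟩]

set_option synthInstance.maxSize 1024 in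
/-- [folklore] The same with the coarse multipliers presented by the COARSE-SITE subtype of the box: `(s, m) ↦ (s, inr m)`, `Torus.proj Lc s̃ = 0`. -/
theorem torus_isUnit_det_kkt_combRows_coarseSites_of_relInv (hr : r ∈ box (d + 1) Lc) (hM : ∀ i, Lc ∣ M i) (hA : Spr A) (hMh : Spr Mh)
    (hAt : ∀ t : Fin (d + 1) → ℤ, shiftK ((Lc : ℤ) • t) A = A) (hMt : ∀ t : Fin (d + 1) → ℤ, shiftK ((Lc : ℤ) • t) Mh = Mh)
    (hrel : RelInv A Mh (axEc (toSite r) Lc))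
    (hmm : ∀ (x y : Fin (d + 1) → ℤ) (κ l : Fin (d + 1)), Mh x y (Sum.inr κ) (Sum.inr l) = 0)
    (hanti : ∀ (x y : Fin (d + 1) → ℤ) (κ l : Fin (d + 1)), Mh x y (Sum.inl κ) (Sum.inr l) = -Mh y x (Sum.inr l) (Sum.inl κ)) :
    IsUnit (kkt
      ((perF M Mh).submatrix (fun b : ↥(pbox M) × Fin (d + 1) => ((b.1, Sum.inl b.2) : Idx M (Fib d)))
        (fun b : ↥(pbox M) × Fin (d + 1) => ((b.1, Sum.inl b.2) : Idx M (Fib d))))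
      (fromRows
        ((perF M Mh).submatrix
          (fun a : {s : ↥(pbox M) // Torus.proj Lc (s : Site (d + 1)) = 0} × Fin (d + 1) => ((a.1.1, Sum.inr a.2) : Idx M (Fib d)))
          (fun b : ↥(pbox M) × Fin (d + 1) => ((b.1, Sum.inl b.2) : Idx M (Fib d))))
        ((combRowsT (toSite r) Lc M).submatrix id (fun b : ↥(pbox M) × Fin (d + 1) => ((b.1, Sum.inl b.2) : Idx M (Fib d)))))).det := by
  refine torus_isUnit_det_kkt_combRows_of_relInv M hr hM hA hMh hAt hMt hrel hmm hanti _ ?_ (fun a => ⟨a.2, rfl⟩)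
    fun s m => ⟨?_, fun hs => ⟨(⟨s, hs⟩, m), rfl⟩⟩
  · rintro ⟨s, m⟩ ⟨s', m'⟩ h
    simp only [Prod.mk.injEq, Sum.inr.injEq] at h
    exact Prod.ext (Subtype.ext h.1) h.2
  · rintro ⟨⟨s', m'⟩, h⟩
    have h1 : (s'.1 : ↥(pbox M)) = s := congrArg Prod.fst h
    exact h1 ▸ s'.2

end CombRows

/-! ## §2 The (INV)-2 transfer on the coarse box, any chart -/

section Transfer

variable {r' : Fin (d + 1) → ℕ} (M' : Fin (d + 1) → ℕ) [∀ i, NeZero (M' i)] {A' Mh' : MKer (d + 1) (Fib d)}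

set_option synthInstance.maxSize 1024 in
/-- **[folklore] (INV)-2 AS A TRANSFER, FIELD-SLOT FORM, ANY CHART** (`RelInvPeriodisedCoarse.coarse_det_kkt_ne_zero_fieldSlot` with the chart displayed).  A chart
`(A′, 𝕄′)` on the coarse box `M′` (root `toSite r′`, the seven letters); fields presented by `fieldSlot ∘ e`, slice rows by `eρ`, averaging rows by any injective
coarse-multiplier presentation `fμ′`; `M̂′ := perF M′ 𝕄′`.  IF `F = c • M̂′∘(fields∘e, fields∘e)` (`c ≠ 0`), `Q₂₀ = M̂′∘(fμ′, fields∘e)`, `τ₂ = (combRowsT (toSite r′) Lc M′)∘(eρ, fields∘e)`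
THEN `det kkt F [Q₂₀; τ₂] ≠ 0`. -/
theorem coarse_det_kkt_ne_zero_fieldSlot_of_relInv (hr' : r' ∈ box (d + 1) Lc) (hM' : ∀ i, Lc ∣ M' i) (hA : Spr A') (hMh : Spr Mh')
    (hAt : ∀ t : Fin (d + 1) → ℤ, shiftK ((Lc : ℤ) • t) A' = A') (hMt : ∀ t : Fin (d + 1) → ℤ, shiftK ((Lc : ℤ) • t) Mh' = Mh')
    (hrel : RelInv A' Mh' (axEc (toSite r') Lc))
    (hmm : ∀ (x y : Fin (d + 1) → ℤ) (κ l : Fin (d + 1)), Mh' x y (Sum.inr κ) (Sum.inr l) = 0)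
    (hanti : ∀ (x y : Fin (d + 1) → ℤ) (κ l : Fin (d + 1)), Mh' x y (Sum.inl κ) (Sum.inr l) = -Mh' y x (Sum.inr l) (Sum.inl κ))
    {κ : Type*} [Fintype κ] [DecidableEq κ] (fμ' : κ → Idx M' (Fib d)) (hfμ' : Function.Injective fμ')
    (hμ' : ∀ a : κ, ∃ m : Fin (d + 1), (fμ' a).2 = Sum.inr m)
    (hcoarse' : ∀ (s : ↥(pbox M')) (m : Fin (d + 1)), ((s, Sum.inr m) : Idx M' (Fib d)) ∈ Set.range fμ' ↔ Torus.proj Lc (s : Site (d + 1)) = 0)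
    {μ ρ₂ : Type*} [Fintype μ] [DecidableEq μ] [Fintype ρ₂] [DecidableEq ρ₂]
    (e : μ ≃ ↥(pbox M') × Fin (d + 1)) (eρ : ρ₂ ≃ Res (toSite r') Lc M') {c : ℝ} (hc : c ≠ 0)
    {F : Matrix μ μ ℝ} {Q₂₀ : Matrix κ μ ℝ} {τ₂ : Matrix ρ₂ μ ℝ}
    (hId : F = c • (perF M' Mh').submatrix
      (fun b : μ => (((e b).1, Sum.inl (e b).2) : Idx M' (Fib d))) (fun b : μ => (((e b).1, Sum.inl (e b).2) : Idx M' (Fib d))))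
    (hQ : Q₂₀ = (perF M' Mh').submatrix fμ' (fun b : μ => (((e b).1, Sum.inl (e b).2) : Idx M' (Fib d))))
    (hτ : τ₂ = (combRowsT (toSite r') Lc M').submatrix eρ (fun b : μ => (((e b).1, Sum.inl (e b).2) : Idx M' (Fib d)))) :
    (kkt F (fromRows Q₂₀ τ₂)).det ≠ 0 := by
  subst hId hQ hτ
  have key := (torus_isUnit_det_kkt_combRows_of_relInv M' hr' hM' hA hMh hAt hMt hrel hmm hanti fμ' hfμ' hμ' hcoarse').ne_zero
  set P := perF M' Mh' with hP
  set fs : ↥(pbox M') × Fin (d + 1) → Idx M' (Fib d) := fun b => (b.1, Sum.inl b.2) with hfs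
  change (kkt (c • (P.submatrix fs fs).submatrix e e)
    (fromRows ((P.submatrix fμ' fs).submatrix id e) (((combRowsT (toSite r') Lc M').submatrix id fs).submatrix eρ e))).det ≠ 0
  rw [det_kkt_smul_form_ne_zero_iff hc, det_kkt_fromRows_submatrix_equiv]
  exact key

set_option synthInstance.maxSize 1024 in
/-- **[folklore] (INV)-2 AS A TRANSFER — ANY INJECTIVE FIELD PRESENTATION ONTO THE FIELD SLOTS, ANY CHART** (`coarse_det_kkt_ne_zero` with the chart displayed). -/
theorem coarse_det_kkt_ne_zero_of_relInv (hr' : r' ∈ box (d + 1) Lc) (hM' : ∀ i, Lc ∣ M' i) (hA : Spr A') (hMh : Spr Mh')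
    (hAt : ∀ t : Fin (d + 1) → ℤ, shiftK ((Lc : ℤ) • t) A' = A') (hMt : ∀ t : Fin (d + 1) → ℤ, shiftK ((Lc : ℤ) • t) Mh' = Mh')
    (hrel : RelInv A' Mh' (axEc (toSite r') Lc))
    (hmm : ∀ (x y : Fin (d + 1) → ℤ) (κ l : Fin (d + 1)), Mh' x y (Sum.inr κ) (Sum.inr l) = 0)
    (hanti : ∀ (x y : Fin (d + 1) → ℤ) (κ l : Fin (d + 1)), Mh' x y (Sum.inl κ) (Sum.inr l) = -Mh' y x (Sum.inr l) (Sum.inl κ))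
    {κ : Type*} [Fintype κ] [DecidableEq κ] (fμ' : κ → Idx M' (Fib d)) (hfμ' : Function.Injective fμ')
    (hμ' : ∀ a : κ, ∃ m : Fin (d + 1), (fμ' a).2 = Sum.inr m)
    (hcoarse' : ∀ (s : ↥(pbox M')) (m : Fin (d + 1)), ((s, Sum.inr m) : Idx M' (Fib d)) ∈ Set.range fμ' ↔ Torus.proj Lc (s : Site (d + 1)) = 0)
    {μ ρ₂ : Type*} [Fintype μ] [DecidableEq μ] [Fintype ρ₂] [DecidableEq ρ₂]
    (fν' : μ → Idx M' (Fib d)) (hfν' : Function.Injective fν') (hν' : ∀ b, ∃ α : Fin (d + 1), (fν' b).2 = Sum.inl α)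
    (hfield : ∀ (s : ↥(pbox M')) (α : Fin (d + 1)), ((s, Sum.inl α) : Idx M' (Fib d)) ∈ Set.range fν')
    (eρ : ρ₂ ≃ Res (toSite r') Lc M') {c : ℝ} (hc : c ≠ 0)
    {F : Matrix μ μ ℝ} {Q₂₀ : Matrix κ μ ℝ} {τ₂ : Matrix ρ₂ μ ℝ}
    (hId : F = c • (perF M' Mh').submatrix fν' fν')
    (hQ : Q₂₀ = (perF M' Mh').submatrix fμ' fν')
    (hτ : τ₂ = (combRowsT (toSite r') Lc M').submatrix eρ fν') :
    (kkt F (fromRows Q₂₀ τ₂)).det ≠ 0 := by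
  obtain ⟨e, he⟩ := exists_fieldSlot_equiv M' fν' hfν' hν' hfield
  have hfe : (fun b : μ => (((e b).1, Sum.inl (e b).2) : Idx M' (Fib d))) = fν' := funext he
  subst hfe
  exact coarse_det_kkt_ne_zero_fieldSlot_of_relInv M' hr' hM' hA hMh hAt hMt hrel hmm hanti fμ' hfμ' hμ' hcoarse' e eρ hc hId hQ hτ

set_option synthInstance.maxSize 1024 in
/-- **[folklore] (INV)-2 AS A TRANSFER — AT THE INDEX TYPES OF RECORD, ANY CHART** (`coarse_det_kkt_ne_zero_record` with the chart displayed: `μ := ↥(pbox M′) × Fin (d+1)`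
read by `(s, α) ↦ (s, inl α)`, `ρ₂ := Res (toSite r′) Lc M′`; no re-indexing). -/
theorem coarse_det_kkt_ne_zero_record_of_relInv (hr' : r' ∈ box (d + 1) Lc) (hM' : ∀ i, Lc ∣ M' i) (hA : Spr A') (hMh : Spr Mh')
    (hAt : ∀ t : Fin (d + 1) → ℤ, shiftK ((Lc : ℤ) • t) A' = A') (hMt : ∀ t : Fin (d + 1) → ℤ, shiftK ((Lc : ℤ) • t) Mh' = Mh')
    (hrel : RelInv A' Mh' (axEc (toSite r') Lc))
    (hmm : ∀ (x y : Fin (d + 1) → ℤ) (κ l : Fin (d + 1)), Mh' x y (Sum.inr κ) (Sum.inr l) = 0)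
    (hanti : ∀ (x y : Fin (d + 1) → ℤ) (κ l : Fin (d + 1)), Mh' x y (Sum.inl κ) (Sum.inr l) = -Mh' y x (Sum.inr l) (Sum.inl κ))
    {κ : Type*} [Fintype κ] [DecidableEq κ] (fμ' : κ → Idx M' (Fib d)) (hfμ' : Function.Injective fμ')
    (hμ' : ∀ a : κ, ∃ m : Fin (d + 1), (fμ' a).2 = Sum.inr m)
    (hcoarse' : ∀ (s : ↥(pbox M')) (m : Fin (d + 1)), ((s, Sum.inr m) : Idx M' (Fib d)) ∈ Set.range fμ' ↔ Torus.proj Lc (s : Site (d + 1)) = 0)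
    {c : ℝ} (hc : c ≠ 0)
    {F : Matrix (↥(pbox M') × Fin (d + 1)) (↥(pbox M') × Fin (d + 1)) ℝ} {Q₂₀ : Matrix κ (↥(pbox M') × Fin (d + 1)) ℝ}
    {τ₂ : Matrix (Res (toSite r') Lc M') (↥(pbox M') × Fin (d + 1)) ℝ}
    (hId : F = c • (perF M' Mh').submatrix
      (fun b : ↥(pbox M') × Fin (d + 1) => ((b.1, Sum.inl b.2) : Idx M' (Fib d))) (fun b : ↥(pbox M') × Fin (d + 1) => ((b.1, Sum.inl b.2) : Idx M' (Fib d))))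
    (hQ : Q₂₀ = (perF M' Mh').submatrix fμ' (fun b : ↥(pbox M') × Fin (d + 1) => ((b.1, Sum.inl b.2) : Idx M' (Fib d))))
    (hτ : τ₂ = (combRowsT (toSite r') Lc M').submatrix id (fun b : ↥(pbox M') × Fin (d + 1) => ((b.1, Sum.inl b.2) : Idx M' (Fib d)))) :
    (kkt F (fromRows Q₂₀ τ₂)).det ≠ 0 :=
  coarse_det_kkt_ne_zero_fieldSlot_of_relInv M' hr' hM' hA hMh hAt hMt hrel hmm hanti fμ' hfμ' hμ' hcoarse' (Equiv.refl _) (Equiv.refl _) hc hId hQ hτ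

end Transfer

end Summit.QuantumFields.BalabanUV.Beta.FP.RelInvPeriodisedChartCombRows

end
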